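import Mathlib.Tactic

/-!
# STUB-PLAN v3.2 certificate — arm M″ re-read on the LEAD skeleton v12 (GV → strict seam `S3d`)

Stub-critic g15 (`scrit-stub_heegnerIndexLowerAtTwo`), crux `PrintCf2.SplitBadTwoLowerHalfOfFacts`
(stmt-BirchSwinnertonDyer-27851).  ℤ-shadows only (valuations as integers); nothing here proves the
stub, the crux or BSD.  Dictionary (STUB-PLAN v3.2 §4 (T3.6-M″)):

* member `W`, anchor `W₀` on the SAME dyadic key; `A = v₂ Ш_an(W)`, `B = v₂ #Ш(W/ℚ)[2^∞]`, `g` the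
  Tamagawa/torsion/log bracket; `m` = S2′'s Katz valuation; `n'` = valuation of the GREENBERG–VATSAL
  (unramified-at-v̄) characteristic series at `T = 0` (what every T1 road delivers, v12 `S3b′`);
  `n` = the STRICT restricted one (`S3c`, theorem `restrictedControl_two_holds`: `n = B + g + eC`);
  `S3d` (v12 `stub_strictDefectAtVbar_two`): `n' = n + eδ(key)`; for LOWER only `n' ≤ n + eδ` at the
  member and `n₀ + eδ ≤ n'₀` at the anchor are consumed;
* T1⁻ cofactor form (§3 (vii)): `2 n' = m − e + ρ + 2ε + 2σ` with `ε ≥ 0` (2-torsion defect of the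
  Δ-sandwich), `σ` = T=0-valuation of the elliptic-unit GENERATION cofactor, `e` (R2c-iv′ digits) and
  `ρ` (sister constant) keyed / global;
* `armM_v12_of_T1minus`: `A ≤ B` EXACTLY from the member halves, the anchor halves, `BSD₂(W₀)`,
  the floor (F-A) `eA₀ ≤ eA`, `σ₀ ≤ σ` and `ε₀ = 0` — `eC`, `eδ`, `e`, `ρ`, `g` cancel;
* `sigma_floor_of_classConstant`: row 36 (k3-g13) + the critic's finite-index sharpening make
  `σ = σ₀ = v₂(c)` a class constant, so `σ₀ ≤ σ` is automatic;
* `eps0_loadBearing`: WITHOUT `ε₀ = 0` (R106) the same data allow `A = B + 1`;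
* `armM_v12_of_T1minus_lowerAnchor` / `…_oddShaAnAnchor` (row 37, k1-g13): the anchor enters only
  through `A₀ ≤ B₀`; an odd-`Ш_an` member is a free anchor; `upperAnchor_insufficient`: `B₀ ≤ A₀` is not;
* `strictDefect_memberDependent_sharp`: if `eδ` were member-dependent (`eδ(W) = eδ(W₀) + 1`) the same
  data allow `A = B + 1` — the floor (C-δ) `eδ(W) ≤ eδ(W₀)` is then load-bearing (v12 states `eδ` KEYED,
  so (C-δ) is an equality and automatic).
-/

set_option linter.dupNamespace false

namespace Summit.BirchSwinnertonDyer.BirchSwinnertonDyer.Cruxes.SplitBadTwoLowerHalfOfFacts.StubPlanT3ArmMSecondV12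

/-- Arm M″ on skeleton v12: exact LOWER `A ≤ B` on an anchored key, with the GV → strict seam `S3d`
(keyed `eδ`) inserted between the T1 road (GV currency `n'`) and the S3c theorem (strict `n`). -/
theorem armM_v12_of_T1minus
    (A B g m n n' e ρ ε σ eA eC eδ A₀ B₀ g₀ m₀ n₀ n'₀ ε₀ σ₀ eA₀ : ℤ)
    (hS2 : 2 * (A + g) + eA ≤ m)                       -- S2′, member half
    (hT1 : 2 * n' = m - e + ρ + 2 * ε + 2 * σ)         -- T1⁻ cofactor identity (GV currency)
    (hε : 0 ≤ ε)                                       -- 2-torsion defect, any member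
    (hσ : σ₀ ≤ σ)                                      -- generation cofactor floor (row 36: equality)
    (hS3d : n' ≤ n + eδ)                               -- S3d, member half
    (hS3c : n = B + g + eC)                            -- S3c theorem at the member
    (hS2₀ : m₀ ≤ 2 * (A₀ + g₀) + eA₀)                  -- S2′, anchor half
    (hT1₀ : 2 * n'₀ = m₀ - e + ρ + 2 * ε₀ + 2 * σ₀)    -- T1⁻ at the anchor (same key: same e, ρ)
    (hε₀ : ε₀ = 0)                                     -- R106 (reflection μ = 0 for the crossed module)
    (hS3d₀ : n₀ + eδ ≤ n'₀)                            -- S3d, anchor half (same key: same eδ)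
    (hS3c₀ : n₀ = B₀ + g₀ + eC)                        -- S3c theorem at the anchor (same key: same eC)
    (hBSD₀ : A₀ = B₀)                                  -- BSD₂(W₀)
    (hflA : eA₀ ≤ eA) :                                -- floor (F-A)
    A ≤ B := by
  omega

/-- Same, with the seam stated as the keyed EQUALITY v12 displays (`n' = n + eδ` at both curves). -/
theorem armM_v12_of_T1minus_keyedSeam
    (A B g m n n' e ρ ε σ eA eC eδ A₀ B₀ g₀ m₀ n₀ n'₀ ε₀ σ₀ eA₀ : ℤ)
    (hS2 : 2 * (A + g) + eA ≤ m) (hT1 : 2 * n' = m - e + ρ + 2 * ε + 2 * σ) (hε : 0 ≤ ε)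
    (hσ : σ₀ ≤ σ) (hS3d : n' = n + eδ) (hS3c : n = B + g + eC)
    (hS2₀ : m₀ ≤ 2 * (A₀ + g₀) + eA₀) (hT1₀ : 2 * n'₀ = m₀ - e + ρ + 2 * ε₀ + 2 * σ₀) (hε₀ : ε₀ = 0)
    (hS3d₀ : n'₀ = n₀ + eδ) (hS3c₀ : n₀ = B₀ + g₀ + eC) (hBSD₀ : A₀ = B₀) (hflA : eA₀ ≤ eA) :
    A ≤ B :=
  armM_v12_of_T1minus A B g m n n' e ρ ε σ eA eC eδ A₀ B₀ g₀ m₀ n₀ n'₀ ε₀ σ₀ eA₀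
    hS2 hT1 hε hσ (le_of_eq hS3d) hS3c hS2₀ hT1₀ hε₀ (le_of_eq hS3d₀.symm) hS3c₀ hBSD₀ hflA

/-- Row 36 (k3-g13) + the critic's finite-index form Σ1′: the generation cofactor is `(c)` for a
lattice constant `c`, the SAME at member and anchor, hence the floor `σ₀ ≤ σ` is automatic. -/
theorem sigma_floor_of_classConstant (σ σ₀ vc : ℤ) (hW : σ = vc) (h₀ : σ₀ = vc) : σ₀ ≤ σ := by
  omega

/-- The member's `ε ≥ 0` and `σ ≥ σ₀` never hurt LOWER: the member inequality in isolation. -/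
theorem member_lower_of_T1minus (A B g m n n' e ρ ε σ eA eC eδ : ℤ)
    (hS2 : 2 * (A + g) + eA ≤ m) (hT1 : 2 * n' = m - e + ρ + 2 * ε + 2 * σ) (hε : 0 ≤ ε)
    (hσ : 0 ≤ σ) (hS3d : n' ≤ n + eδ) (hS3c : n = B + g + eC) :
    2 * A ≤ 2 * B + (2 * eC + 2 * eδ + e - ρ - eA) := by
  omega

/-- R106 is load-bearing: drop `ε₀ = 0` and the remaining hypotheses of `armM_v12_of_T1minus`
are consistent with `A = B + 1` (witness: key table `eδ = 1`, anchor 2-torsion defect `ε₀ = 1`). -/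
theorem eps0_loadBearing :
    ∃ (A B g m n n' e ρ ε σ eA eC eδ A₀ B₀ g₀ m₀ n₀ n'₀ ε₀ σ₀ eA₀ : ℤ),
      2 * (A + g) + eA ≤ m ∧ 2 * n' = m - e + ρ + 2 * ε + 2 * σ ∧ 0 ≤ ε ∧ σ₀ ≤ σ ∧
      n' ≤ n + eδ ∧ n = B + g + eC ∧ m₀ ≤ 2 * (A₀ + g₀) + eA₀ ∧
      2 * n'₀ = m₀ - e + ρ + 2 * ε₀ + 2 * σ₀ ∧ n₀ + eδ ≤ n'₀ ∧ n₀ = B₀ + g₀ + eC ∧ A₀ = B₀ ∧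
      eA₀ ≤ eA ∧ ε₀ = 1 ∧ A = B + 1 :=
  ⟨1, 0, 0, 2, 0, 1, 0, 0, 0, 0, 0, 0, 1, 0, 0, 0, 0, 0, 1, 1, 0, 0, by norm_num⟩

/-- If the strict defect were MEMBER-dependent (`eδ(W) = eδ(W₀) + 1`), everything else tight, the
data allow `A = B + 1`: the floor (C-δ) `eδ(W) ≤ eδ(W₀)` would be load-bearing.  v12 states `eδ`
keyed (`∃ eδ : ℤ → ℤ → ℤ`), under which (C-δ) is an equality. -/
theorem strictDefect_memberDependent_sharp :
    ∃ (A B g m n n' e ρ ε σ eA eC eδW eδ₀ A₀ B₀ g₀ m₀ n₀ n'₀ ε₀ σ₀ eA₀ : ℤ),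
      2 * (A + g) + eA ≤ m ∧ 2 * n' = m - e + ρ + 2 * ε + 2 * σ ∧ 0 ≤ ε ∧ σ₀ ≤ σ ∧
      n' = n + eδW ∧ n = B + g + eC ∧ m₀ ≤ 2 * (A₀ + g₀) + eA₀ ∧
      2 * n'₀ = m₀ - e + ρ + 2 * ε₀ + 2 * σ₀ ∧ ε₀ = 0 ∧ n'₀ = n₀ + eδ₀ ∧ n₀ = B₀ + g₀ + eC ∧
      A₀ = B₀ ∧ eA₀ ≤ eA ∧ eδW = eδ₀ + 1 ∧ A = B + 1 :=
  ⟨1, 0, 0, 2, 0, 1, 0, 0, 0, 0, 0, 0, 1, 0, 0, 0, 0, 0, 0, 0, 0, 0, 0, by norm_num⟩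

/-- With the floor (C-δ) `eδ(W) ≤ eδ(W₀)` in place of keyed-ness, LOWER is exact again. -/
theorem armM_v12_of_T1minus_deltaFloor
    (A B g m n n' e ρ ε σ eA eC eδW eδ₀ A₀ B₀ g₀ m₀ n₀ n'₀ ε₀ σ₀ eA₀ : ℤ)
    (hS2 : 2 * (A + g) + eA ≤ m) (hT1 : 2 * n' = m - e + ρ + 2 * ε + 2 * σ) (hε : 0 ≤ ε)
    (hσ : σ₀ ≤ σ) (hS3d : n' ≤ n + eδW) (hS3c : n = B + g + eC)
    (hS2₀ : m₀ ≤ 2 * (A₀ + g₀) + eA₀) (hT1₀ : 2 * n'₀ = m₀ - e + ρ + 2 * ε₀ + 2 * σ₀) (hε₀ : ε₀ = 0)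
    (hS3d₀ : n₀ + eδ₀ ≤ n'₀) (hS3c₀ : n₀ = B₀ + g₀ + eC) (hBSD₀ : A₀ = B₀) (hflA : eA₀ ≤ eA)
    (hflδ : eδW ≤ eδ₀) :
    A ≤ B := by
  omega

/-- Cross-key residual on v12 (R96′/R104): transporting the anchor of key `k₀` to a member of key `k`
costs exactly the table differences; `eδ` now sits in the table next to `eC` (B9 / S3d: expected
`eδ(1,3) − eδ(1,7) = 2 + a`, so PLAN C's «only eC» is false). -/
theorem armM_v12_crossKey
    (A B g m n n' e ρ ε σ eA eC eδ A₀ B₀ g₀ m₀ n₀ n'₀ e₀ ρ₀ ε₀ σ₀ eA₀ eC₀ eδ₀ : ℤ)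
    (hS2 : 2 * (A + g) + eA ≤ m) (hT1 : 2 * n' = m - e + ρ + 2 * ε + 2 * σ) (hε : 0 ≤ ε)
    (hσ : σ₀ ≤ σ) (hS3d : n' ≤ n + eδ) (hS3c : n = B + g + eC)
    (hS2₀ : m₀ ≤ 2 * (A₀ + g₀) + eA₀) (hT1₀ : 2 * n'₀ = m₀ - e₀ + ρ₀ + 2 * ε₀ + 2 * σ₀) (hε₀ : ε₀ = 0)
    (hS3d₀ : n₀ + eδ₀ ≤ n'₀) (hS3c₀ : n₀ = B₀ + g₀ + eC₀) (hBSD₀ : A₀ = B₀) (hflA : eA₀ ≤ eA) :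
    2 * A ≤ 2 * B + (2 * (eC - eC₀) + 2 * (eδ - eδ₀) + ((e - ρ) - (e₀ - ρ₀))) := by
  omega

/-- Row 37 (k1-g13) on skeleton v12: the anchor is consumed ONLY through its LOWER half `A₀ ≤ B₀`
(`MissingLowerBoundAt W₀ 2`), not through `BSD₂(W₀)`. -/
theorem armM_v12_of_T1minus_lowerAnchor
    (A B g m n n' e ρ ε σ eA eC eδ A₀ B₀ g₀ m₀ n₀ n'₀ ε₀ σ₀ eA₀ : ℤ)
    (hS2 : 2 * (A + g) + eA ≤ m) (hT1 : 2 * n' = m - e + ρ + 2 * ε + 2 * σ) (hε : 0 ≤ ε)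
    (hσ : σ₀ ≤ σ) (hS3d : n' ≤ n + eδ) (hS3c : n = B + g + eC)
    (hS2₀ : m₀ ≤ 2 * (A₀ + g₀) + eA₀) (hT1₀ : 2 * n'₀ = m₀ - e + ρ + 2 * ε₀ + 2 * σ₀) (hε₀ : ε₀ = 0)
    (hS3d₀ : n₀ + eδ ≤ n'₀) (hS3c₀ : n₀ = B₀ + g₀ + eC) (hLow₀ : A₀ ≤ B₀) (hflA : eA₀ ≤ eA) :
    A ≤ B := by
  omega

/-- Critic's corollary of rows 36 + 37 + R106: a member `W₀` of the key with ODD analytic Sha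
(`A₀ = v₂ Ш_an(W₀) = 0`) is an admissible anchor with NO algebraic input on `Ш(W₀)` (`0 ≤ B₀` is free,
junk value included) — the anchor then costs S2′'s `≤` half, the T1 road's ES-direction, S3d/S3c, and the
COMPUTATION `v₂ Ш_an(W₀) = 0`. -/
theorem armM_v12_of_T1minus_oddShaAnAnchor
    (A B g m n n' e ρ ε σ eA eC eδ A₀ B₀ g₀ m₀ n₀ n'₀ ε₀ σ₀ eA₀ : ℤ)
    (hS2 : 2 * (A + g) + eA ≤ m) (hT1 : 2 * n' = m - e + ρ + 2 * ε + 2 * σ) (hε : 0 ≤ ε)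
    (hσ : σ₀ ≤ σ) (hS3d : n' ≤ n + eδ) (hS3c : n = B + g + eC)
    (hS2₀ : m₀ ≤ 2 * (A₀ + g₀) + eA₀) (hT1₀ : 2 * n'₀ = m₀ - e + ρ + 2 * ε₀ + 2 * σ₀) (hε₀ : ε₀ = 0)
    (hS3d₀ : n₀ + eδ ≤ n'₀) (hS3c₀ : n₀ = B₀ + g₀ + eC) (hA₀ : A₀ = 0) (hB₀ : 0 ≤ B₀) (hflA : eA₀ ≤ eA) :
    A ≤ B :=
  armM_v12_of_T1minus_lowerAnchor A B g m n n' e ρ ε σ eA eC eδ A₀ B₀ g₀ m₀ n₀ n'₀ ε₀ σ₀ eA₀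
    hS2 hT1 hε hσ hS3d hS3c hS2₀ hT1₀ hε₀ hS3d₀ hS3c₀ (by omega) hflA

/-- The LOWER-anchor half is load-bearing in the right direction: with `B₀ ≤ A₀` (the UPPER half, what a
Kolyvagin bound gives) in place of `A₀ ≤ B₀`, the data allow `A = B + 1`. -/
theorem upperAnchor_insufficient :
    ∃ (A B g m n n' e ρ ε σ eA eC eδ A₀ B₀ g₀ m₀ n₀ n'₀ ε₀ σ₀ eA₀ : ℤ),
      2 * (A + g) + eA ≤ m ∧ 2 * n' = m - e + ρ + 2 * ε + 2 * σ ∧ 0 ≤ ε ∧ σ₀ ≤ σ ∧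
      n' ≤ n + eδ ∧ n = B + g + eC ∧ m₀ ≤ 2 * (A₀ + g₀) + eA₀ ∧
      2 * n'₀ = m₀ - e + ρ + 2 * ε₀ + 2 * σ₀ ∧ ε₀ = 0 ∧ n₀ + eδ ≤ n'₀ ∧ n₀ = B₀ + g₀ + eC ∧
      B₀ ≤ A₀ ∧ eA₀ ≤ eA ∧ A = B + 1 :=
  ⟨1, 0, 0, 2, 0, 1, 0, 0, 0, 0, 0, 0, 1, 1, 0, 0, 2, 0, 1, 0, 0, 0, by norm_num⟩

end Summit.BirchSwinnertonDyer.BirchSwinnertonDyer.Cruxes.SplitBadTwoLowerHalfOfFacts.StubPlanT3ArmMSecondV12
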